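import Summits.QuantumFields.YangMills.Theorems.BalabanUVNodesN19SingleModeFirstOrder
import Mathlib.Analysis.SpecialFunctions.Log.Base

/-!
# YM-DAG node N19 (= NE7 proper) — THE FIRST-ORDER TAIL CORRECTION, PART 2: THE SINGLE-MODE LAW IS LOG-FREE —
# `dist_∞(e^{iωΣ_{i≤d}|x_i|}, Π_t) ≤ 80·ωd∕t` for all `t ≥ 512`, `ω ≥ 0`, `d` with `ωd·log₂²t ≤ t∕2048`

Cell `pub-ymgap`, HUMAN RULING D-0062 (Track A) ∕ D-0149 (work-bound push), R141 (C) wider-strategy seat `pub-ymgap-dag-n19-e` (strategy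
s3 = ALTERNATIVE CURRENCY), generation g32, module 2 (lineage module 140).  Route `Summits/QuantumFields/YangMills/Theses/BalabanUVNodes.lean`,
cluster item K3⁸ «SpineGivenEndpointR13SepCoPHV» (stmt-QuantumFields-27366); filed `--supports` that item `--as helper` (it proves no registered
stub).  COUNT-NEUTRAL: [folklore]∕[bookkeeping] over Mathlib (`Nat.find`, `Real.logb`, `Nat.ceil`) and PART 1 `…N19SingleModeFirstOrder` BY NAME
(`exists_pair_near_cexp_l1Norm_firstOrder`, `exists_pair_near_cexp_l1Norm_emptyLadder`); no laws, no scheme object, no Theses import; NOT a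
discharge claim.

CONTENT.  PART 1 proves the single mode of the ℓ¹-norm in the parametric form «ladder of height `J` (Taylor order `h`) × first-order additive
correction at scale `N`»: total degree `≤ 2e²ωd(½ + π + 3πJ) + 2h(2^{J+1} − 1) + 2N`, error
`≤ 2(J+1)e^{−h}(1 + ρ + τ) + ρ² + τ`, `ρ = ωdπ∕2^J ≤ 1`, `τ = ωdπ∕N`.  This module chooses the parameters at a prescribed budget `t`
(`a := ωd`, `L := log₂t ≥ 9`, regime `a·L² ≤ t∕2048`):
§1 `exists_ladderParameters` — when `π²at > 64`: `J` = the least natural with `π²at ≤ 64·4^J` (so `J ≥ 1`, `16·4^J < π²at`, whence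
`ρ² ≤ 64a∕t`, `ρ ≤ 1`, and `2^J·181L < πt` from `(2^J·181L)² ≤ 2048·16·4^J·L² < 2048π²at·L² ≤ (πt)²`), `h = ⌈3 log t⌉` (`e^{−h} ≤ t^{−3}`,
`h ≤ 2.2L`, `(J+1)e^{−h} ≤ 1∕(4t²) ≤ ½`, `2(J+1)e^{−h} ≤ 1∕(2t²) ≤ a∕t`); the ladder's degree is `≤ 146·aL + 8.8·L·2^J ≤ t∕100 + 4t∕25 ≤ t∕4`.
§2 ★★★ `exists_pair_near_cexp_l1Norm_logFree` — THE LOG-FREE SINGLE-MODE LAW: for all `t ≥ 512`, `ω ≥ 0` and finite `ι` with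
`ωd·(log₂t)² ≤ t∕2048` there is a pair of real `MvPolynomial`s of total degree `≤ t` with `‖Cr(x) + Ci(x)·i − e^{iωΣ_i|x_i|}‖ ≤ 80·ωd∕t` on
`[−1,1]^ι` (`N = ⌊3t∕8⌋ ≥ t∕4`, `τ ≤ 4πa∕t`; if `π²at ≤ 64` PART 1's EMPTY ladder: `(a∕2)² + τ ≤ (2 + 4π)a∕t`; else §1 and PART 1's parametric
form: `3·a∕t + 64a∕t + 4πa∕t ≤ 80a∕t`) · ★★ `exists_mvPolynomial_near_cos_l1Norm_logFree` ∕ `…_sin_…` (real faces).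
READING (CURRENCY-MAP v10 ∕ OPEN-PROBLEM.md g30–g31 open item «is the `log t` of the single-mode law real?», honest): NO — in the whole regime
`ωd ≤ t∕(2048·log₂²t)` the single-mode law is `dist_∞(e^{iωS_d}, Π_t) ≤ 80·ωd∕t`, LINEAR in `ωd∕t` with NO logarithm, uniformly in `d`; with the
diagonal lower bound `ωd∕(20πt)` of modules 134∕135 (`ωd ≤ t∕10`, `t ≥ 6`) the law is `Θ(ωd∕t)` up to the absolute constant `80·20π` there.
What stays open: the corner `t∕(2048 log₂²t) < ωd ≤ t∕10` (there modules 119∕122's `300log₂t(log₂t + 4ωd)∕t` is still the upper side; a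
higher-order tail correction would shrink the corner to `ωd ≳ t∕log t`), and all constants (`80`, `2048`, `512` are nowhere optimised: Taylor instead
of Chebyshev, Jackson constant `2π`, `e²` safety factor, `h` uniform over the levels).

HONEST FRAMING (binding).  Elementary and [folklore]; ONE-SIDED (upper bounds); NO consumer in the DAG today (an optimality map of the seat's own
currency, degree model); nothing of Bałaban's instantiated; NE7 NOT PRINTED, NOT proved; N19 NOT discharged; count-neutral.  One finite `T⁴` programme
at fixed `ε`; nothing continuum ∕ `ℝ⁴` ∕ OS ∕ mass-gap ∕ Clay.  0 `def` ∕ 0 `sorry`.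
-/

noncomputable section

open Finset Complex
open scoped Real

namespace Summit.QuantumFields.YangMills.Theorems.BalabanUVNodesN19SingleModeLogFree

open Summit.QuantumFields.YangMills.Theorems.BalabanUVNodesN19SingleModeFirstOrder
  (exists_pair_near_cexp_l1Norm_firstOrder exists_pair_near_cexp_l1Norm_emptyLadder)

variable {ι : Type*} [Fintype ι]

/-! ## §1 The parameters of the ladder at budget `t` [bookkeeping] -/

/-- `log₂t ≥ 9` for `t ≥ 512`. [bookkeeping] -/
theorem nine_le_logb {t : ℕ} (ht : 512 ≤ t) : 9 ≤ Real.logb 2 t := by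
  have ht0 : (0 : ℝ) < t := by exact_mod_cast (show 0 < t by omega)
  have htr : (512 : ℝ) ≤ t := by exact_mod_cast ht
  rw [Real.le_logb_iff_rpow_le one_lt_two ht0]
  have e : (2 : ℝ) ^ (9 : ℝ) = 512 := by norm_num
  rw [e]; exact htr

/-- **THE SCALE `2^J ≍ √(at)`.**  Let `t ≥ 512`, `a ≥ 0`, `a·(log₂t)² ≤ t∕2048`, `π²at > 64`, and `J` the least natural with `π²at ≤ 64·4^J`.
Then `J ≥ 1` and `16·4^J < π²at`, whence `(aπ∕2^J)² ≤ 64a∕t`, `aπ ≤ 2^J`, `2^J·181·log₂t < πt` (squares: `(2^J·181L)² ≤ 2048·16·4^J·L² <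
2048π²at·L² ≤ (πt)²`) and `2^J ≤ t∕4`. [bookkeeping] -/
theorem exists_scale {t : ℕ} (ht : 512 ≤ t) {a : ℝ} (ha : 0 ≤ a)
    (hreg : a * Real.logb 2 t ^ 2 ≤ t / 2048) (hbig : 64 < π ^ 2 * a * t) :
    ∃ J : ℕ, (2 : ℝ) ^ J ≤ t / 4 ∧ a * π ≤ 2 ^ J ∧ (a * π / 2 ^ J) ^ 2 ≤ 64 * a / t ∧
      2 ^ J * (181 * Real.logb 2 t) < π * t := by
  classical
  set L : ℝ := Real.logb 2 t with hL
  have ht0 : (0 : ℝ) < t := by exact_mod_cast (show 0 < t by omega)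
  have hπhi : π < 3.15 := Real.pi_lt_d2
  have hL9 : 9 ≤ L := nine_le_logb ht
  -- the least `J` with `π²at ≤ 64·4^J`
  have hex : ∃ J : ℕ, π ^ 2 * a * t ≤ 64 * 4 ^ J := by
    obtain ⟨n, hn⟩ := pow_unbounded_of_one_lt (π ^ 2 * a * t / 64) (by norm_num : (1 : ℝ) < 4)
    refine ⟨n, ?_⟩
    rw [div_lt_iff₀ (by norm_num : (0 : ℝ) < 64)] at hn
    linarith only [hn]
  set J : ℕ := Nat.find hex with hJ
  have hJspec : π ^ 2 * a * t ≤ 64 * 4 ^ J := Nat.find_spec hex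
  have hJpos : 0 < J := by
    rw [Nat.pos_iff_ne_zero]
    intro h0
    have h1 := hJspec
    rw [h0, pow_zero, mul_one] at h1
    linarith only [h1, hbig]
  have hJmin : 64 * (4 : ℝ) ^ (J - 1) < π ^ 2 * a * t := lt_of_not_ge (Nat.find_min hex (show J - 1 < J by omega))
  have h4J : (4 : ℝ) ^ J = 4 * 4 ^ (J - 1) := by
    rw [← pow_succ']
    congr 1
    omega
  have h16 : 16 * (4 : ℝ) ^ J < π ^ 2 * a * t := by rw [h4J]; linarith only [hJmin]
  have hM2 : ((2 : ℝ) ^ J) ^ 2 = 4 ^ J := by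
    rw [← pow_mul, mul_comm, pow_mul]; norm_num
  have hM0 : (0 : ℝ) < 2 ^ J := by positivity
  -- `ρ² ≤ 64a/t`, `ρ ≤ 1`
  have hρsq : (a * π / 2 ^ J) ^ 2 ≤ 64 * a / t := by
    rw [div_pow, mul_pow, hM2, div_le_div_iff₀ (by positivity) ht0]
    have h1 := mul_le_mul_of_nonneg_left hJspec ha
    nlinarith only [h1]
  have ha64 : 64 * a ≤ t := by
    have h1 : a * 81 ≤ a * L ^ 2 := mul_le_mul_of_nonneg_left (by nlinarith only [hL9]) ha
    linarith only [h1, hreg]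
  have hρ0 : 0 ≤ a * π / 2 ^ J := by positivity
  have hρ1 : a * π / 2 ^ J ≤ 1 := by
    have h1 : (a * π / 2 ^ J) ^ 2 ≤ 1 := hρsq.trans (by rw [div_le_one ht0]; exact ha64)
    nlinarith only [h1, hρ0]
  have hP4 : a * π ≤ 2 ^ J := by rwa [div_le_one hM0] at hρ1
  -- `2^J·181L < πt`
  have hMlt : 2 ^ J * (181 * L) < π * t := by
    have hsq : (2 ^ J * (181 * L)) ^ 2 < (π * t) ^ 2 := by
      calc (2 ^ J * (181 * L)) ^ 2 = 4 ^ J * (32761 * L ^ 2) := by rw [mul_pow, hM2]; ring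
        _ ≤ 4 ^ J * (32768 * L ^ 2) := by gcongr; norm_num
        _ = 2048 * (16 * 4 ^ J) * L ^ 2 := by ring
        _ < 2048 * (π ^ 2 * a * t) * L ^ 2 := by gcongr
        _ = π ^ 2 * t * (2048 * (a * L ^ 2)) := by ring
        _ ≤ π ^ 2 * t * t := by gcongr; linarith only [hreg]
        _ = (π * t) ^ 2 := by ring
    exact lt_of_pow_lt_pow_left₀ 2 (by positivity) hsq
  have hP3 : (2 : ℝ) ^ J ≤ t / 4 := by
    have h1 : 2 ^ J * (181 * 9) ≤ 2 ^ J * (181 * L) := by gcongr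
    nlinarith only [hMlt, h1, hπhi, ht0, hM0]
  exact ⟨J, hP3, hP4, hρsq, hMlt⟩

/-- **THE TAYLOR ORDER `h = ⌈3 log t⌉`.**  For `t ≥ 512`: `h ≥ 1`, `h ≤ 2.2·log₂t` and `e^{−h} ≤ 1∕t³`. [bookkeeping] -/
theorem exists_order {t : ℕ} (ht : 512 ≤ t) :
    ∃ h : ℕ, 1 ≤ h ∧ (h : ℝ) ≤ 2.2 * Real.logb 2 t ∧ Real.exp (-(h : ℝ)) ≤ 1 / (t : ℝ) ^ 3 := by
  set L : ℝ := Real.logb 2 t with hL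
  have ht0 : (0 : ℝ) < t := by exact_mod_cast (show 0 < t by omega)
  have htr : (512 : ℝ) ≤ t := by exact_mod_cast ht
  have hL9 : 9 ≤ L := nine_le_logb ht
  have hlog2 : Real.log 2 < 0.6932 := by linarith only [Real.log_two_lt_d9]
  have hlogt : Real.log t = L * Real.log 2 := by
    rw [hL, Real.logb, div_mul_cancel₀ _ (Real.log_pos one_lt_two).ne']
  have hlogt0 : 0 < Real.log t := Real.log_pos (by linarith only [htr])
  refine ⟨⌈3 * Real.log t⌉₊, Nat.one_le_iff_ne_zero.2 (Nat.pos_iff_ne_zero.1 (Nat.ceil_pos.2 (by positivity))), ?_, ?_⟩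
  · have h1 : ((⌈3 * Real.log t⌉₊ : ℕ) : ℝ) < 3 * Real.log t + 1 := Nat.ceil_lt_add_one (by positivity)
    have hL0 : 0 ≤ L := by linarith only [hL9]
    have h3 : Real.log t ≤ L * 0.6932 := by rw [hlogt]; exact mul_le_mul_of_nonneg_left hlog2.le hL0
    linarith only [h1, h3, hL9]
  · have h3 : 3 * Real.log t ≤ ⌈3 * Real.log t⌉₊ := Nat.le_ceil _
    have e3 : Real.exp (3 * Real.log t) = (t : ℝ) ^ 3 := by
      rw [show (3 : ℝ) * Real.log t = ((3 : ℕ) : ℝ) * Real.log t by norm_num, Real.exp_nat_mul, Real.exp_log ht0]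
    calc Real.exp (-((⌈3 * Real.log t⌉₊ : ℕ) : ℝ)) ≤ Real.exp (-(3 * Real.log t)) := Real.exp_le_exp.2 (by linarith only [h3])
      _ = 1 / (t : ℝ) ^ 3 := by rw [Real.exp_neg, e3, inv_eq_one_div]

/-- **THE LADDER PARAMETERS AT BUDGET `t`.**  Let `t ≥ 512`, `a ≥ 0` with `a·(log₂t)² ≤ t∕2048` and `π²at > 64`.  Then there are `J, h : ℕ` with
`h ≥ 1`, `(J+1)e^{−h} ≤ ½`, `2^J ≤ t∕4`, `aπ ≤ 2^J`, `(aπ∕2^J)² ≤ 64a∕t`, `2(J+1)e^{−h} ≤ a∕t` and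
`2e²a(½ + π + 3πJ) + 2h(2^{J+1} − 1) ≤ t∕4` (the scale and the order above; `J + 1 ≤ 2^J ≤ t∕4`, `J + 1 ≤ log₂t`; the degree of the ladder is
`≤ 146·a·log₂t + 8.8·log₂t·2^J ≤ t∕100 + 4t∕25`). [bookkeeping] -/
theorem exists_ladderParameters {t : ℕ} (ht : 512 ≤ t) {a : ℝ} (ha : 0 ≤ a)
    (hreg : a * Real.logb 2 t ^ 2 ≤ t / 2048) (hbig : 64 < π ^ 2 * a * t) :
    ∃ J h : ℕ, 1 ≤ h ∧ ((J : ℝ) + 1) * Real.exp (-(h : ℝ)) ≤ 1 / 2 ∧ (2 : ℝ) ^ J ≤ t / 4 ∧ a * π ≤ 2 ^ J ∧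
      (a * π / 2 ^ J) ^ 2 ≤ 64 * a / t ∧ 2 * ((J : ℝ) + 1) * Real.exp (-(h : ℝ)) ≤ a / t ∧
      2 * Real.exp 2 * a * (1 / 2 + π + 3 * π * J) + 2 * h * (2 ^ (J + 1) - 1) ≤ t / 4 := by
  set L : ℝ := Real.logb 2 t with hL
  have ht0 : (0 : ℝ) < t := by exact_mod_cast (show 0 < t by omega)
  have htr : (512 : ℝ) ≤ t := by exact_mod_cast ht
  have hπlo : 3.14 < π := Real.pi_gt_d2
  have hπhi : π < 3.15 := Real.pi_lt_d2
  have hL9 : 9 ≤ L := nine_le_logb ht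
  have hL0 : 0 < L := by linarith only [hL9]
  obtain ⟨J, hP3, hP4, hP5, hMlt⟩ := exists_scale ht ha hreg hbig
  obtain ⟨h, hh1, hhle, hexph⟩ := exists_order ht
  have hM0 : (0 : ℝ) < 2 ^ J := by positivity
  -- `(J+1)e^{-h} ≤ 1/(4t²)`
  have hJ12J : (J : ℝ) + 1 ≤ 2 ^ J := by
    have h1 : J + 1 ≤ 2 ^ J := Nat.lt_two_pow_self
    exact_mod_cast h1
  have hJ1 : (J : ℝ) + 1 ≤ t / 4 := hJ12J.trans hP3
  have hε : ((J : ℝ) + 1) * Real.exp (-(h : ℝ)) ≤ 1 / (4 * t ^ 2) := by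
    calc ((J : ℝ) + 1) * Real.exp (-(h : ℝ)) ≤ (t / 4) * (1 / t ^ 3) :=
          mul_le_mul hJ1 hexph (Real.exp_pos _).le (by positivity)
      _ = 1 / (4 * t ^ 2) := by field_simp
  have hP2 : ((J : ℝ) + 1) * Real.exp (-(h : ℝ)) ≤ 1 / 2 := by
    refine hε.trans ?_
    rw [div_le_div_iff₀ (by positivity) (by norm_num : (0 : ℝ) < 2)]
    nlinarith only [htr]
  have hP6 : 2 * ((J : ℝ) + 1) * Real.exp (-(h : ℝ)) ≤ a / t := by
    have hat0' : 0 ≤ a * t := mul_nonneg ha ht0.le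
    have hππ : π * π < 3.15 * 3.15 := mul_lt_mul'' hπhi hπhi Real.pi_pos.le Real.pi_pos.le
    have hπ2 : π ^ 2 ≤ 9.93 := by rw [pow_two]; linarith only [hππ]
    have h0 : π ^ 2 * a * t ≤ 9.93 * (a * t) := by rw [mul_assoc]; exact mul_le_mul_of_nonneg_right hπ2 hat0'
    have hat : 6 < a * t := by linarith only [h0, hbig]
    have h1 : 2 * ((J : ℝ) + 1) * Real.exp (-(h : ℝ)) ≤ 2 * (1 / (4 * t ^ 2)) := by linarith only [hε]
    refine h1.trans ?_
    have e1 : 2 * (1 / (4 * (t : ℝ) ^ 2)) = 1 / (2 * t ^ 2) := by field_simp; norm_num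
    rw [e1, div_le_div_iff₀ (by positivity) ht0, one_mul]
    have e2 : a * (2 * (t : ℝ) ^ 2) = t * (2 * (a * t)) := by ring
    rw [e2]
    exact le_mul_of_one_le_right ht0.le (by linarith only [hat])
  -- the degree of the ladder
  have he2 : Real.exp 2 ≤ 7.4 := by
    have he1 : Real.exp 1 ≤ 2.7182818286 := Real.exp_one_lt_d9.le
    have he0 : 0 < Real.exp 1 := Real.exp_pos 1
    have : Real.exp 2 = Real.exp 1 * Real.exp 1 := by rw [← Real.exp_add]; norm_num
    rw [this]; nlinarith only [he1, he0]
  have hJ1L : (J : ℝ) + 1 ≤ L := by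
    have h2J1 : (2 : ℝ) ^ (J + 1) ≤ t := by rw [pow_succ]; linarith only [hP3]
    rw [hL, Real.le_logb_iff_rpow_le one_lt_two ht0]
    have e : (2 : ℝ) ^ ((J : ℝ) + 1) = 2 ^ (J + 1) := by rw [← Real.rpow_natCast]; push_cast; ring_nf
    rw [e]; exact h2J1
  have hJ0 : (0 : ℝ) ≤ J := Nat.cast_nonneg _
  have haL1 : a * L ≤ t / 18432 := by
    have h1 : a * L * 9 ≤ a * L * L := mul_le_mul_of_nonneg_left hL9 (mul_nonneg ha hL0.le)
    nlinarith only [h1, hreg]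
  have hterm1 : 2 * Real.exp 2 * a * (1 / 2 + π + 3 * π * J) ≤ t / 100 := by
    have hX0 : (0 : ℝ) ≤ 1 / 2 + π + 3 * π * J := by positivity
    have s1 : 2 * Real.exp 2 * a * (1 / 2 + π + 3 * π * J) ≤ 14.8 * (a * (1 / 2 + π + 3 * π * J)) := by
      nlinarith only [mul_nonneg (sub_nonneg.2 he2) (mul_nonneg ha hX0)]
    have s2 : 1 / 2 + π + 3 * π * (J : ℝ) ≤ 3.65 + 9.45 * L := by
      nlinarith only [mul_nonneg (sub_nonneg.2 hπhi.le) hJ0, hπhi, hJ1L]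
    have s3 : a * (1 / 2 + π + 3 * π * J) ≤ a * (3.65 + 9.45 * L) := mul_le_mul_of_nonneg_left s2 ha
    have s4 : a * (3.65 + 9.45 * L) ≤ 9.86 * (a * L) := by
      nlinarith only [mul_nonneg ha (by linarith only [hL9] : (0 : ℝ) ≤ L - 9), ha]
    nlinarith only [s1, s3, s4, haL1, ht0]
  have hterm2 : 2 * (h : ℝ) * (2 ^ (J + 1) - 1) ≤ 4 * t / 25 := by
    have hh0 : (0 : ℝ) ≤ h := Nat.cast_nonneg _
    have s1 : 2 * (h : ℝ) * (2 ^ (J + 1) - 1) ≤ 4 * h * 2 ^ J := by rw [pow_succ]; nlinarith only [hM0, hh0]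
    have s2 : 4 * (h : ℝ) * 2 ^ J ≤ 8.8 * (L * 2 ^ J) := by nlinarith only [hhle, hM0]
    have s3 : L * 2 ^ J * 181 < π * t := by linarith only [hMlt]
    nlinarith only [s1, s2, s3, hπhi, ht0]
  refine ⟨J, h, hh1, hP2, hP3, hP4, hP5, hP6, ?_⟩
  linarith only [hterm1, hterm2, ht0]

/-! ## §2 ★★★ The log-free single-mode law [folklore] -/

/-- The error bookkeeping of the ladder case: `ε₁(1 + ρ + τ) + ρ² + τ ≤ 80a∕t` when `ε₁ ≤ a∕t`, `0 ≤ ρ ≤ 1`, `ρ² ≤ 64a∕t`,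
`0 ≤ τ ≤ min(1, 4πa∕t)`. [bookkeeping] -/
theorem errorBound_ladder {ε₁ ρ τ a t : ℝ} (ht : 0 < t) (ha : 0 ≤ a) (hε : ε₁ ≤ a / t) (hρ0 : 0 ≤ ρ)
    (hρ1 : ρ ≤ 1) (hρsq : ρ ^ 2 ≤ 64 * a / t) (hτ0 : 0 ≤ τ) (hτ1 : τ ≤ 1) (hτ : τ ≤ 4 * π * a / t) :
    ε₁ * (1 + ρ + τ) + ρ ^ 2 + τ ≤ 80 * a / t := by
  have hπhi : π < 3.15 := Real.pi_lt_d2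
  have hat0 : 0 ≤ a / t := div_nonneg ha ht.le
  have s1 : ε₁ * (1 + ρ + τ) ≤ a / t * 3 := mul_le_mul hε (by linarith only [hρ1, hτ1]) (by positivity) hat0
  have h80 : a / t * 3 + 64 * a / t + 4 * π * a / t ≤ 80 * a / t := by
    have e : a / t * 3 + 64 * a / t + 4 * π * a / t = (67 + 4 * π) * a / t := by ring
    rw [e]
    exact div_le_div_of_nonneg_right (by nlinarith only [hπhi, ha]) ht.le
  linarith only [s1, hρsq, hτ, h80]

/-- The error bookkeeping of the empty-ladder case: if `π²at ≤ 64`, `a ≥ 0`, `t ≥ 512` then `a ≤ 2` and `(a∕2)² + τ ≤ 80a∕t` whenever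
`τ ≤ 4πa∕t`. [bookkeeping] -/
theorem errorBound_empty {τ a t : ℝ} (ht : 512 ≤ t) (ha : 0 ≤ a) (hA : π ^ 2 * a * t ≤ 64) (hτ : τ ≤ 4 * π * a / t) :
    a ≤ 2 ∧ (a / 2) ^ 2 + τ ≤ 80 * a / t := by
  have ht0 : 0 < t := by linarith only [ht]
  have hπlo : 3.14 < π := Real.pi_gt_d2
  have hπhi : π < 3.15 := Real.pi_lt_d2
  have hππ : 3.14 * 3.14 < π * π := mul_lt_mul'' hπlo hπlo (by norm_num) (by norm_num)
  have hπ2lo : 9 ≤ π ^ 2 := by rw [pow_two]; linarith only [hππ]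
  have h1 : 9 * (a * 512) ≤ π ^ 2 * (a * t) :=
    mul_le_mul hπ2lo (mul_le_mul_of_nonneg_left ht ha) (by positivity) (by positivity)
  have h2 : π ^ 2 * (a * t) = π ^ 2 * a * t := by ring
  refine ⟨by linarith only [h1, h2, hA], ?_⟩
  have h3 : (a / 2) ^ 2 ≤ 2 * a / t := by
    rw [div_pow, div_le_div_iff₀ (by norm_num) ht0]
    have h4 := mul_le_mul_of_nonneg_left hA ha
    nlinarith only [h4, mul_nonneg (sub_nonneg.2 hπ2lo) (by positivity : (0 : ℝ) ≤ a ^ 2 * t), ha]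
  have h80 : 2 * a / t + 4 * π * a / t ≤ 80 * a / t := by
    rw [← add_div]
    exact div_le_div_of_nonneg_right (by nlinarith only [hπhi, ha]) ht0.le
  linarith only [h3, hτ, h80]

/-- ★★★ **THE SINGLE-MODE LAW IS LOG-FREE.**  For all `t ≥ 512`, `ω ≥ 0` and finite `ι` (`d = |ι|`) with `ωd·(log₂t)² ≤ t∕2048` there is a pair of
real `MvPolynomial`s `(Cr, Ci)` of total degree `≤ t` with `‖Cr(x) + Ci(x)·i − e^{iωΣ_i|x_i|}‖ ≤ 80·ωd∕t` on `[−1,1]^ι`.  With `a = ωd`,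
`N = ⌊3t∕8⌋` (`N ≥ t∕4`, `ωdπ∕N ≤ 4πa∕t`): if `π²at ≤ 64`, PART 1's empty ladder (`(a∕2)² ≤ 2a∕t`); otherwise the parameters of §1 in PART 1's
`exists_pair_near_cexp_l1Norm_firstOrder` (degree `≤ t∕4 + 2N ≤ t`; error `≤ (a∕t)(1 + ρ + τ) + 64a∕t + 4πa∕t ≤ 80a∕t`).
READING: `dist_∞(e^{iωS_d}, Π_t) ≤ 80·ωd∕t` — NO `log t` — against modules 119∕122's `300log₂t(log₂t + 4ωd)∕t` and the lower bound `ωd∕(20πt)` of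
modules 134∕135: the single-mode law is `Θ(ωd∕t)` for `ωd ≤ t∕(2048 log₂²t)`. [folklore] -/
theorem exists_pair_near_cexp_l1Norm_logFree {t : ℕ} (ht : 512 ≤ t) {ω : ℝ} (hω : 0 ≤ ω)
    (hreg : ω * Fintype.card ι * Real.logb 2 t ^ 2 ≤ t / 2048) :
    ∃ Cr Ci : MvPolynomial ι ℝ, Cr.totalDegree ≤ t ∧ Ci.totalDegree ≤ t ∧
      ∀ x : ι → ℝ, (∀ i, x i ∈ Set.Icc (-1 : ℝ) 1) →
        ‖((MvPolynomial.eval x Cr : ℝ) : ℂ) + ((MvPolynomial.eval x Ci : ℝ) : ℂ) * I - exp (((ω * ∑ i, |x i| : ℝ) : ℂ) * I)‖ ≤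
          80 * (ω * Fintype.card ι) / t := by
  set d : ℝ := (Fintype.card ι : ℝ) with hd
  set a : ℝ := ω * d with ha
  have hd0 : 0 ≤ d := Nat.cast_nonneg _
  have ha0 : 0 ≤ a := mul_nonneg hω hd0
  have ht0 : (0 : ℝ) < t := by exact_mod_cast (show 0 < t by omega)
  have htr : (512 : ℝ) ≤ t := by exact_mod_cast ht
  -- the correction scale `N = ⌊3t/8⌋`
  set N : ℕ := 3 * t / 8 with hN
  have hNpos : 0 < N := by omega
  have h2N : 2 * N ≤ t := by omega
  have hN4 : (t : ℝ) / 4 ≤ N := by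
    have h1 : ((3 * t : ℕ) : ℝ) ≤ ((8 * N + 7 : ℕ) : ℝ) := by exact_mod_cast (show 3 * t ≤ 8 * N + 7 by omega)
    push_cast at h1
    linarith only [h1, htr]
  have hNr : (0 : ℝ) < N := by exact_mod_cast hNpos
  have hτ : a * π / N ≤ 4 * π * a / t := by
    rw [div_le_div_iff₀ hNr ht0]
    nlinarith only [hN4, mul_nonneg ha0 Real.pi_pos.le]
  by_cases hA : π ^ 2 * a * t ≤ 64
  · -- the empty ladder
    obtain ⟨ha2, herr⟩ := errorBound_empty htr ha0 hA hτ
    obtain ⟨Cr, Ci, hCr, hCi, happ⟩ := exists_pair_near_cexp_l1Norm_emptyLadder (ι := ι) hω hNpos ha2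
    exact ⟨Cr, Ci, hCr.trans h2N, hCi.trans h2N, fun x hx => (happ x hx).trans herr⟩
  · -- the ladder with the first-order correction
    have hbig : 64 < π ^ 2 * a * t := lt_of_not_ge hA
    obtain ⟨J, h, hh1, hP2, hP3, hP4, hP5, hP6, hP7⟩ := exists_ladderParameters ht ha0 hreg hbig
    have hNJ : 2 ^ J ≤ N := by
      have h1 : ((2 ^ J : ℕ) : ℝ) ≤ (N : ℝ) := by push_cast; linarith only [hP3, hN4]
      exact_mod_cast h1
    obtain ⟨Cr, Ci, hCr, hCi, happ⟩ := exists_pair_near_cexp_l1Norm_firstOrder (ι := ι) hω J h N hh1 hP2 hNJ hP4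
    have h2Nr : (2 * N : ℝ) ≤ 3 * t / 4 := by
      have h1 : ((8 * N : ℕ) : ℝ) ≤ ((3 * t : ℕ) : ℝ) := by exact_mod_cast (show 8 * N ≤ 3 * t by omega)
      push_cast at h1
      linarith only [h1]
    have hdeg : 2 * Real.exp 2 * ω * d * (1 / 2 + π + 3 * π * J) + 2 * h * (2 ^ (J + 1) - 1) + 2 * N ≤ (t : ℝ) := by
      have e : 2 * Real.exp 2 * ω * d * (1 / 2 + π + 3 * π * J) = 2 * Real.exp 2 * a * (1 / 2 + π + 3 * π * J) := by
        rw [ha]; ring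
      rw [e]; linarith only [hP7, h2Nr]
    refine ⟨Cr, Ci, Nat.cast_le.1 (hCr.trans hdeg), Nat.cast_le.1 (hCi.trans hdeg), fun x hx => (happ x hx).trans ?_⟩
    have h2J : (0 : ℝ) < 2 ^ J := by positivity
    have hρ1 : a * π / 2 ^ J ≤ 1 := by rw [div_le_one h2J]; exact hP4
    have ha64 : 64 * a ≤ t := by
      have h1 : a * 81 ≤ a * Real.logb 2 t ^ 2 := mul_le_mul_of_nonneg_left (by nlinarith only [nine_le_logb ht]) ha0
      linarith only [h1, hreg]
    have hτ1 : a * π / N ≤ 1 := by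
      refine hτ.trans ?_
      rw [div_le_one ht0]
      have h1 : 4 * π * a ≤ 4 * 3.15 * a := mul_le_mul_of_nonneg_right (by linarith only [Real.pi_lt_d2]) ha0
      linarith only [h1, ha64]
    exact errorBound_ladder ht0 ha0 hP6 (by positivity) hρ1 hP5 (by positivity) hτ1 hτ

/-- ★★ **REAL FACE: `dist_∞(cos(ωΣ_{i≤d}|x_i|), Π_t) ≤ 80·ωd∕t`** for all `t ≥ 512`, `ω ≥ 0`, `d` with `ωd·log₂²t ≤ t∕2048` (the real part of the
pair).  OPEN-PROBLEM.md reformulation 3 asked for `dist_∞(cos(ωS_k), Π_t) ≤ ψ(kω∕t)` uniformly in `k`: here `ψ(c′) = 80c′` on `c′ ≤ 1∕(2048 log₂²t)`.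
[folklore] -/
theorem exists_mvPolynomial_near_cos_l1Norm_logFree {t : ℕ} (ht : 512 ≤ t) {ω : ℝ} (hω : 0 ≤ ω)
    (hreg : ω * Fintype.card ι * Real.logb 2 t ^ 2 ≤ t / 2048) :
    ∃ P : MvPolynomial ι ℝ, P.totalDegree ≤ t ∧
      ∀ x : ι → ℝ, (∀ i, x i ∈ Set.Icc (-1 : ℝ) 1) →
        |Real.cos (ω * ∑ i, |x i|) - MvPolynomial.eval x P| ≤ 80 * (ω * Fintype.card ι) / t := by
  obtain ⟨Cr, Ci, hCr, -, happ⟩ := exists_pair_near_cexp_l1Norm_logFree (ι := ι) ht hω hreg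
  refine ⟨Cr, hCr, fun x hx => ?_⟩
  have hre : (((MvPolynomial.eval x Cr : ℝ) : ℂ) + ((MvPolynomial.eval x Ci : ℝ) : ℂ) * I -
          exp (((ω * ∑ i, |x i| : ℝ) : ℂ) * I)).re = MvPolynomial.eval x Cr - Real.cos (ω * ∑ i, |x i|) := by
    simp only [Complex.sub_re, Complex.add_re, Complex.mul_re, Complex.ofReal_re, Complex.ofReal_im, Complex.I_re,
      Complex.I_im, Complex.exp_ofReal_mul_I_re]
    ring
  rw [abs_sub_comm, ← hre]
  exact (Complex.abs_re_le_norm _).trans (happ x hx)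

/-- ★★ **REAL FACE: `dist_∞(sin(ωΣ_{i≤d}|x_i|), Π_t) ≤ 80·ωd∕t`** for all `t ≥ 512`, `ω ≥ 0`, `d` with `ωd·log₂²t ≤ t∕2048` (the imaginary part).
With module 134's `exists_le_abs_sin_l1Norm_sub_eval` (`≥ ωd∕(20πt)` for `ωd ≤ t∕10`, `t ≥ 6`): `dist_∞(sin(ωS_d), Π_t) = Θ(ωd∕t)` in that regime —
the `log t` (and `log²t`) of CURRENCY-MAP v10's row was the scheme's. [folklore] -/
theorem exists_mvPolynomial_near_sin_l1Norm_logFree {t : ℕ} (ht : 512 ≤ t) {ω : ℝ} (hω : 0 ≤ ω)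
    (hreg : ω * Fintype.card ι * Real.logb 2 t ^ 2 ≤ t / 2048) :
    ∃ P : MvPolynomial ι ℝ, P.totalDegree ≤ t ∧
      ∀ x : ι → ℝ, (∀ i, x i ∈ Set.Icc (-1 : ℝ) 1) →
        |Real.sin (ω * ∑ i, |x i|) - MvPolynomial.eval x P| ≤ 80 * (ω * Fintype.card ι) / t := by
  obtain ⟨Cr, Ci, -, hCi, happ⟩ := exists_pair_near_cexp_l1Norm_logFree (ι := ι) ht hω hreg
  refine ⟨Ci, hCi, fun x hx => ?_⟩
  have him : (((MvPolynomial.eval x Cr : ℝ) : ℂ) + ((MvPolynomial.eval x Ci : ℝ) : ℂ) * I -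
          exp (((ω * ∑ i, |x i| : ℝ) : ℂ) * I)).im = MvPolynomial.eval x Ci - Real.sin (ω * ∑ i, |x i|) := by
    simp only [Complex.sub_im, Complex.add_im, Complex.mul_im, Complex.ofReal_re, Complex.ofReal_im, Complex.I_re,
      Complex.I_im, Complex.exp_ofReal_mul_I_im]
    ring
  rw [abs_sub_comm, ← him]
  exact (Complex.abs_im_le_norm _).trans (happ x hx)

end Summit.QuantumFields.YangMills.Theorems.BalabanUVNodesN19SingleModeLogFree

end
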